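import Mathlib
import Summits.Ventures.PercRepro2.HCov
import Summits.Ventures.PercRepro2.HCovFns
import Summits.Ventures.PercRepro2.HCovCubic
import Summits.Ventures.PercRepro2.TriDisagreement
import Summits.Ventures.PercRepro2.EdgeCubic

/-!
# Row 2′CPOLAR implies the crux: the one-edge Bernstein induction in the mass vocabulary
(blind cell PercRepro2, p5 g14; `proofs/P5-OEDGE.md` §13)

* **`K3_diag`**: the three-copy kernel `K₃` of HCovCubic.lean vanishes on the diagonal,
  `K₃ ω ω ω = 0` (the eight terms cancel in pairs — pure `ring`);
* at a PINNED weight vector (every `p e ∈ {0, 1}`) the measure is the point mass at the configuration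
  `ω₀ e = (p e = 1)` (`weight_pinned`), so the cubic form is `K₃ ω₀ ω₀ ω₀ = 0`: **`Gc_eq_zero_of_pinned`**
  and `HCov_of_pinned_weights` — the base case «`N ≥ 0` on deterministic configurations» of the
  cell's record, in the kernel;
* **`HCov_of_bern`**: if `0 ≤ B1` and `0 ≤ B2` hold at every edge of every admissible weight vector
  on the graph (row 2′CPOLAR at every edge line), then (HCOV) holds for every admissible weight
  vector — induction on the number of fractional edges through `EdgeLine.HCov_of_update_zero_of_bern`;
  and **`HCov_all_of_bern_all : CPolar_all R → HCov_all R`**: the one-edge Bernstein positivity of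
  row 2′CPOLAR implies the crux (the mass-vocabulary twin of `HCov_of_pinned` / `triSum_nonneg_of_pinned`).
-/

namespace Summit.Ventures.PercRepro2

open UnionCluster

namespace CovForm

section Diag

variable {V : Type*} {E : Type*} [Fintype E] [DecidableEq E] {R : Type*} [Field R]

omit [Fintype E] [DecidableEq E] in
/-- **`K₃` vanishes on the diagonal**: `K₃ ω ω ω = 0`. -/
theorem K3_diag (ends : E → Sym2 V) (o a₁ a₂ a₃ b : V) (ω : Config E) :
    K3 (R := R) ends o a₁ a₂ a₃ b ω ω ω = 0 := by
  unfold K3 sepKernel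
  simp only [Fin.sum_univ_succ, Fin.sum_univ_zero, Matrix.cons_val_zero, Matrix.cons_val_succ,
    add_zero]
  unfold f3 f4 f5 f6 f7 f10 f11 f12
  ring

end Diag

section Pinned

variable {V : Type*} {E : Type*} [Fintype E] [DecidableEq E] {R : Type*} [Field R] [LinearOrder R]
  [IsStrictOrderedRing R]

/-- The configuration of a pinned weight vector: `e` open iff `p e = 1`. -/
noncomputable def pinnedConfig (p : E → R) : Config E := fun e => decide (p e = 1)

omit [Fintype E] [DecidableEq E] [IsStrictOrderedRing R] in
/-- At a pinned weight vector every edge factor is the indicator of agreement with `pinnedConfig`. -/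
lemma edgeFactor_pinned (p : E → R) (hp : ∀ e, p e = 0 ∨ p e = 1) (ω : Config E) (e : E) :
    edgeFactor (p e) (ω e) = if ω e = pinnedConfig p e then (1 : R) else 0 := by
  rcases hp e with h | h
  · have h0 : pinnedConfig p e = false := by
      unfold pinnedConfig
      rw [decide_eq_false_iff_not, h]
      exact zero_ne_one
    rw [h, h0]
    cases ω e <;> simp [edgeFactor]
  · have h1 : pinnedConfig p e = true := by
      unfold pinnedConfig
      rw [decide_eq_true_iff]
      exact h
    rw [h, h1]
    cases ω e <;> simp [edgeFactor]

omit [DecidableEq E] [IsStrictOrderedRing R] in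
/-- **A pinned weight vector is the point mass at `pinnedConfig p`.** -/
lemma weight_pinned (p : E → R) (hp : ∀ e, p e = 0 ∨ p e = 1) (ω : Config E) :
    weight p ω = if ω = pinnedConfig p then (1 : R) else 0 := by
  unfold weight
  simp_rw [edgeFactor_pinned p hp ω]
  rw [Finset.prod_boole]
  congr 1
  simp only [Finset.mem_univ, true_implies]
  exact propext ⟨fun h => funext h, fun h e => by rw [h]⟩

omit [IsStrictOrderedRing R] in
/-- At a pinned weight vector the cubic form is `K₃ ω₀ ω₀ ω₀`. -/
lemma triSum_pinned (p : E → R) (hp : ∀ e, p e = 0 ∨ p e = 1) (τ : E → ℕ)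
    (K : Config E → Config E → Config E → R) :
    triSum p ∅ τ K = K (pinnedConfig p) (pinnedConfig p) (pinnedConfig p) := by
  rw [triSum_empty]
  simp_rw [weight_pinned p hp]
  simp [Finset.sum_ite_eq']

/-- **`Gc` vanishes at every pinned weight vector** (the deterministic base case). -/
theorem Gc_eq_zero_of_pinned (p : E → R) (hp : ∀ e, p e = 0 ∨ p e = 1) (ends : E → Sym2 V)
    (o a₁ a₂ a₃ b : V) : Gc p ends o a₁ a₂ a₃ b = 0 := by
  rw [hcov_cubic p ends o a₁ a₂ a₃ b (fun _ => 0), triSum_pinned p hp, K3_diag]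

end Pinned

section Induction

variable {V : Type*} {E : Type*} [Fintype E] [DecidableEq E] {R : Type*} [Field R] [LinearOrder R]
  [IsStrictOrderedRing R]

/-- (HCOV) at a pinned weight vector. -/
theorem HCov_of_pinned_weights (p : E → R) (hp : ∀ e, p e = 0 ∨ p e = 1) (ends : E → Sym2 V)
    (o a₁ a₂ a₃ b : V) : HCov p ends o a₁ a₂ a₃ b := by
  unfold HCov
  rw [Gc_eq_zero_of_pinned p hp]

open EdgeLine

/-- The fractional edges of `p`. -/
def fracEdges (p : E → R) : Finset E := Finset.univ.filter fun e => p e ≠ 0 ∧ p e ≠ 1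

omit [IsStrictOrderedRing R] in
/-- Pinning a fractional edge removes it from the fractional set. -/
lemma fracEdges_update (p : E → R) (e : E) (c : R) (hc : c = 0 ∨ c = 1) :
    fracEdges (Function.update p e c) = (fracEdges p).erase e := by
  ext e'
  simp only [fracEdges, Finset.mem_filter, Finset.mem_univ, true_and, Finset.mem_erase]
  by_cases h : e' = e
  · subst h
    simp only [Function.update_self, ne_eq, not_true_eq_false, false_and, iff_false, not_and,
      not_not]
    rcases hc with hc | hc <;> simp [hc]
  · simp [h]

/-- **(HCOV) from the one-edge Bernstein positivity at every edge of every admissible weight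
vector on the graph** (row 2′CPOLAR on the instance), by induction on the number of fractional
edges. -/
theorem HCov_of_bern (ends : E → Sym2 V) (o a₁ a₂ a₃ b : V)
    (hB : ∀ q : E → R, IsProbVec q → ∀ e, 0 ≤ B1 q ends o a₁ a₂ a₃ b e ∧ 0 ≤ B2 q ends o a₁ a₂ a₃ b e)
    (p : E → R) (hp : IsProbVec p) : HCov p ends o a₁ a₂ a₃ b := by
  generalize hn : (fracEdges p).card = n
  induction n using Nat.strong_induction_on generalizing p with
  | _ n ih =>
    by_cases h0 : fracEdges p = ∅
    · -- every edge is pinned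
      refine HCov_of_pinned_weights p (fun e => ?_) ends o a₁ a₂ a₃ b
      by_contra hc
      rw [not_or] at hc
      have : e ∈ fracEdges p := by simp [fracEdges, hc.1, hc.2]
      rw [h0] at this
      exact absurd this (Finset.notMem_empty e)
    · obtain ⟨e, he⟩ := Finset.nonempty_iff_ne_empty.mpr h0
      have hlt : ((fracEdges p).erase e).card < n := by
        rw [← hn]; exact Finset.card_erase_lt_of_mem he
      have hp₀ : IsProbVec (Function.update p e 0) := hp.update e le_rfl zero_le_one
      have hp₁ : IsProbVec (Function.update p e 1) := hp.update e zero_le_one le_rfl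
      have h₀ : HCov (Function.update p e 0) ends o a₁ a₂ a₃ b :=
        ih _ hlt (Function.update p e 0) hp₀ (by rw [fracEdges_update p e 0 (Or.inl rfl)])
      have h₁ : HCov (Function.update p e 1) ends o a₁ a₂ a₃ b :=
        ih _ hlt (Function.update p e 1) hp₁ (by rw [fracEdges_update p e 1 (Or.inr rfl)])
      exact HCov_of_update_zero_of_bern p hp ends o a₁ a₂ a₃ b e h₀ h₁ (hB p hp e).1 (hB p hp e).2

end Induction

section Closure

variable (R : Type*) [Field R] [LinearOrder R] [IsStrictOrderedRing R]

/-- **Row 2′CPOLAR over every finite graph**: `0 ≤ B1` and `0 ≤ B2` at every edge of every admissible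
weight vector (the binders of `HCov_all`). -/
def CPolar_all : Prop :=
  ∀ (V E : Type) [Fintype V] [DecidableEq V] [Fintype E] [DecidableEq E]
    (ends : E → Sym2 V) (p : E → R), IsProbVec p →
    ∀ o a₁ a₂ a₃ b : V, a₁ ≠ a₂ → a₁ ≠ a₃ → a₂ ≠ a₃ → o ≠ a₁ → o ≠ a₂ → o ≠ a₃ → o ≠ b →
      b ≠ a₁ → b ≠ a₂ → b ≠ a₃ → ∀ e,
        0 ≤ EdgeLine.B1 p ends o a₁ a₂ a₃ b e ∧ 0 ≤ EdgeLine.B2 p ends o a₁ a₂ a₃ b e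

/-- **Row 2′CPOLAR implies the crux**: `CPolar_all R → HCov_all R`. -/
theorem HCov_all_of_cpolar_all (h : CPolar_all R) : HCov_all R := by
  intro V E _ _ _ _ ends p hp o a₁ a₂ a₃ b h1 h2 h3 h4 h5 h6 h7 h8 h9 h10
  exact HCov_of_bern ends o a₁ a₂ a₃ b
    (fun q hq e => h V E ends q hq o a₁ a₂ a₃ b h1 h2 h3 h4 h5 h6 h7 h8 h9 h10 e) p hp

end Closure

end CovForm

end Summit.Ventures.PercRepro2
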